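import Summits.Ventures.LatticeQCDFlow.Scaling.FiniteOddsLumpedLaw
import Summits.Ventures.LatticeQCDFlow.Scaling.HubChainDetailedBalance
import Summits.Ventures.LatticeQCDFlow.Scaling.StepChainResolvent

/-!
HONEST FRAMING: exact (Metropolis-corrected) sampling algorithms for lattice gauge theory; figures
of merit are autocorrelation/cost numbers at stated couplings and volumes; no continuum-physics
claim.

# LumpedStarStepChain — THE STEP CHAIN OF THE LUMPED STAR IN COMPOSITION VARIABLES: THE SWAP STEP `A`, THE REDRAW `B` (IDEMPOTENT), THE STATIONARY LAW
# `π_S(x) ∝ [Π_v (μ_0(v)W_v)^{N(v)}/N(v)!]·N(h)/W_h` FOR WHICH BOTH ARE REVERSIBLE, THE RESOLVENT KERNEL `U` OF `A`, AND `UB =` THE REFRESH-CYCLE CHAIN OF CHAPTER W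
# (the objects of the cycle → step transfer, OPEN-MATH item 1 (i) (b) route (α); lean-2 GEN-38, ours)

Venture-side (OURS).  Cell `lqcd-flow` (pub-lqcd), unit `pub-lqcd-lean-2-g38`, 2026-08-30.  Chapter X (item 1 (i) (b)), file 5.  State space of chapter W file 27 (`x ↦ (hub x, comp x)`,
`Σ comp x = K+1`, `comp x (hub x) ≠ 0`, injective and exhaustive), star-hub kernels `Kh`, resolvent end-hub laws `u` at swap odds `σ`.  The STEP chain is `S = σA + (1−σ)B`:
`A(x,x') = 𝟙{comp x' = comp x}·Kh(comp x)(hub x, hub x')` (one swap attempt), `B(x,x') = μ_0(hub x')·𝟙{comp x' + δ_{hub x} = comp x + δ_{hub x'}}` (the redraw).  This file proves what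
files X1–X4 take as hypotheses: `A`, `B` have unit row sums and are non-negative; `B² = B`; both are reversible w.r.t.
`π_S(x) = g(comp x)·comp x(hub x)/(W_{hub x}·Z)`, `g(N) = Π_v (μ_0(v)W_v)^{N(v)}/N(v)!` (for `B` through `g(M + δ_h)(M(h)+1) = μ_0(h)W_h·g(M)`); the kernel
`U(x,x') = 𝟙{comp x' = comp x}·u_x(hub x')` satisfies the resolvent hypothesis-equation of X1; and `UB` is the refresh-cycle kernel `P` of W27.  Hypothesis-equations, no definitions.

## What is proved

* `star_fiber_card`, `star_sum_fiber` (sums over the states of one composition), `starStep_swap_rowsum`, `starStep_swap_nonneg`, `starStep_swap_reversible`, `star_redraw_fiber_card`,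
  `starStep_redraw_rowsum`, `starStep_redraw_idem`, `star_weight_succ`, `starStep_redraw_reversible`, `starStep_resolvent_row`, `starStep_resolvent_col`, `starStep_cycle_eq`.

Reading (no numerics implied): the lumped star's stationary law is the Poissonised multinomial in `μ_1 ∝ μ_0W` for the `K+1` particles with the hub particle reweighted by `1/W`
(i.e. of law `μ_0`).  Literature grade (cell rule): OWN, elementary; nothing cited as a fact; no new bib keys.
-/

open Finset

namespace Summit.Ventures.LatticeQCDFlow.Scaling

section StarStep
variable {X : Type*} [Fintype X] {S : Type*} [Fintype S] [DecidableEq S]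
variable {hub : X → S} {comp : X → S → ℕ} {K : ℕ} {μ0 W : S → ℝ} {σ : ℝ} {acc : S → S → ℝ} {Kh : (S → ℕ) → S → S → ℝ} {u : X → S → ℝ}
variable {Ast Bst Ust : X → X → ℝ}

/-! ## §1 The states of one composition -/

/-- For a composition `N` with `Σ N = K+1`: the states `x'` with `hub x' = z`, `comp x' = N` number `1` if `N(z) ≠ 0` and `0` otherwise. [ours] -/
theorem star_fiber_card (hinj : ∀ x x', hub x = hub x' → comp x = comp x' → x = x')
    (hsurj : ∀ (z : S) (N : S → ℕ), ∑ v, N v = K + 1 → N z ≠ 0 → ∃ x, hub x = z ∧ comp x = N) (hhub : ∀ x, comp x (hub x) ≠ 0)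
    (z : S) (N : S → ℕ) (hN : ∑ v, N v = K + 1) :
    ((univ.filter fun x' => hub x' = z ∧ comp x' = N).card : ℝ) = if N z = 0 then 0 else 1 := by
  by_cases hz : N z = 0
  · rw [if_pos hz]
    have : (univ.filter fun x' => hub x' = z ∧ comp x' = N) = ∅ := by
      refine filter_eq_empty_iff.mpr fun x' _ h => ?_
      obtain ⟨h1, h2⟩ := h
      exact hhub x' (by rw [h2, h1]; exact hz)
    rw [this]; simp
  · rw [if_neg hz]
    obtain ⟨x₀, hx₀, hc₀⟩ := hsurj z N hN hz
    have : (univ.filter fun x' => hub x' = z ∧ comp x' = N) = {x₀} := by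
      refine eq_singleton_iff_unique_mem.mpr ⟨mem_filter.mpr ⟨mem_univ _, hx₀, hc₀⟩, fun x' hx' => ?_⟩
      obtain ⟨-, h1, h2⟩ := mem_filter.mp hx'
      exact hinj x' x₀ (h1.trans hx₀.symm) (h2.trans hc₀.symm)
    rw [this]; simp

/-- **Summing over the states of one composition:** `Σ_{x'} 𝟙{comp x' = N}·φ(hub x') = Σ_{v : N(v) ≠ 0} φ(v)`. [ours] -/
theorem star_sum_fiber (hinj : ∀ x x', hub x = hub x' → comp x = comp x' → x = x')
    (hsurj : ∀ (z : S) (N : S → ℕ), ∑ v, N v = K + 1 → N z ≠ 0 → ∃ x, hub x = z ∧ comp x = N) (hhub : ∀ x, comp x (hub x) ≠ 0)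
    (N : S → ℕ) (hN : ∑ v, N v = K + 1) (φ : S → ℝ) :
    ∑ x', (if comp x' = N then φ (hub x') else 0) = ∑ v, (if N v = 0 then 0 else φ v) := by
  classical
  -- `𝟙{comp x' = N}φ(hub x') = Σ_v 𝟙{hub x' = v ∧ comp x' = N} φ v`
  have e1 : ∀ x', (if comp x' = N then φ (hub x') else 0) = ∑ v, (if hub x' = v ∧ comp x' = N then φ v else 0) := by
    intro x'
    rw [show (∑ v, (if hub x' = v ∧ comp x' = N then φ v else 0)) = ∑ v, (if hub x' = v then (if comp x' = N then φ v else 0) else 0) from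
      sum_congr rfl fun v _ => by by_cases h1 : hub x' = v <;> by_cases h2 : comp x' = N <;> simp [h1, h2]]
    rw [Finset.sum_ite_eq]; simp
  simp_rw [e1]
  rw [sum_comm]
  refine sum_congr rfl fun v _ => ?_
  rw [← Finset.sum_filter, sum_const, nsmul_eq_mul, star_fiber_card hinj hsurj hhub v N hN]
  split_ifs <;> simp

/-! ## §2 The swap step `A` -/

/-- **`A` has unit row sums.** [ours] -/
theorem starStep_swap_rowsum (hinj : ∀ x x', hub x = hub x' → comp x = comp x' → x = x')
    (hsurj : ∀ (z : S) (N : S → ℕ), ∑ v, N v = K + 1 → N z ≠ 0 → ∃ x, hub x = z ∧ comp x = N) (hhub : ∀ x, comp x (hub x) ≠ 0) (hsum : ∀ x, ∑ v, comp x v = K + 1)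
    (hKoff : ∀ N h v, h ≠ v → Kh N h v = if N h = 0 then 0 else (N v : ℝ) / K * acc h v) (hKdiag : ∀ N h, Kh N h h = 1 - ∑ v ∈ univ.erase h, Kh N h v)
    (hA : ∀ x x', Ast x x' = if comp x' = comp x then Kh (comp x) (hub x) (hub x') else 0) (x : X) : ∑ x', Ast x x' = 1 := by
  rw [sum_congr rfl fun x' _ => hA x x', star_sum_fiber hinj hsurj hhub (comp x) (hsum x) (fun v => Kh (comp x) (hub x) v)]
  rw [← starHub_rowsum (hKdiag (comp x)) (hub x)]
  refine sum_congr rfl fun v _ => ?_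
  by_cases hv : comp x v = 0
  · rw [if_pos hv, starHub_closed (hKoff (comp x)) (hhub x) hv]
  · rw [if_neg hv]

omit [Fintype X] in
/-- `A ≥ 0`. [ours] -/
theorem starStep_swap_nonneg (hW : ∀ v, 0 < W v) (hacc : ∀ h v, acc h v = min 1 (W h / W v)) (hK : 1 ≤ K) (hsum : ∀ x, ∑ v, comp x v = K + 1)
    (hKoff : ∀ N h v, h ≠ v → Kh N h v = if N h = 0 then 0 else (N v : ℝ) / K * acc h v) (hKdiag : ∀ N h, Kh N h h = 1 - ∑ v ∈ univ.erase h, Kh N h v)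
    (hA : ∀ x x', Ast x x' = if comp x' = comp x then Kh (comp x) (hub x) (hub x') else 0) (x x' : X) : 0 ≤ Ast x x' := by
  rw [hA]; split_ifs
  · exact starHub_nonneg hW hacc (hKoff (comp x)) (hKdiag (comp x)) hK (hsum x) _ _
  · exact le_rfl

variable {g : (S → ℕ) → ℝ} {πS : X → ℝ} {Z : ℝ}

omit [Fintype X] in
/-- **`A` is reversible w.r.t. `π_S`** (within a composition the hub chain is reversible w.r.t. `N/W`, chapter V file 8). [ours] -/
theorem starStep_swap_reversible (hinj : ∀ x x', hub x = hub x' → comp x = comp x' → x = x') (hhub : ∀ x, comp x (hub x) ≠ 0)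
    (hW : ∀ v, 0 < W v) (hacc : ∀ h v, acc h v = min 1 (W h / W v))
    (hKoff : ∀ N h v, h ≠ v → Kh N h v = if N h = 0 then 0 else (N v : ℝ) / K * acc h v)
    (hA : ∀ x x', Ast x x' = if comp x' = comp x then Kh (comp x) (hub x) (hub x') else 0)
    (hπS : ∀ x, πS x = g (comp x) * ((comp x (hub x) : ℝ) / W (hub x)) / Z) (x x' : X) : πS x * Ast x x' = πS x' * Ast x' x := by
  rw [hA x x', hA x' x]
  by_cases hc : comp x' = comp x
  · rw [if_pos hc, if_pos hc.symm, hπS, hπS, hc]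
    by_cases hh : hub x = hub x'
    · have : x = x' := hinj x x' hh hc.symm
      subst this; rfl
    · rw [hKoff _ _ _ hh, hKoff _ _ _ (Ne.symm hh), if_neg (hhub x), if_neg (by rw [← hc]; exact hhub x')]
      have e := hub_acc_mul_inv hW hacc (hub x) (hub x')
      have e' := hub_acc_mul_inv hW hacc (hub x') (hub x)
      rw [min_comm] at e'
      have hWx := hW (hub x); have hWx' := hW (hub x')
      calc g (comp x) * ((comp x (hub x) : ℝ) / W (hub x)) / Z * ((comp x (hub x') : ℝ) / K * acc (hub x) (hub x'))
          = g (comp x) / Z * ((comp x (hub x) : ℝ) * (comp x (hub x') : ℝ) / K) * (acc (hub x) (hub x') / W (hub x)) := by ring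
        _ = g (comp x) / Z * ((comp x (hub x) : ℝ) * (comp x (hub x') : ℝ) / K) * (acc (hub x') (hub x) / W (hub x')) := by rw [e, e']
        _ = g (comp x) * ((comp x (hub x') : ℝ) / W (hub x')) / Z * ((comp x (hub x) : ℝ) / K * acc (hub x') (hub x)) := by ring
  · rw [if_neg hc, if_neg (fun h => hc h.symm), mul_zero, mul_zero]

/-! ## §3 The redraw `B` -/

/-- The redraw fibre: for each fresh content `z` exactly one state `x'` has `hub x' = z` and `comp x' + δ_{hub x} = comp x + δ_z`. [ours] -/
theorem star_redraw_fiber_card (hinj : ∀ x x', hub x = hub x' → comp x = comp x' → x = x')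
    (hsurj : ∀ (z : S) (N : S → ℕ), ∑ v, N v = K + 1 → N z ≠ 0 → ∃ x, hub x = z ∧ comp x = N) (hhub : ∀ x, comp x (hub x) ≠ 0)
    (hsum : ∀ x, ∑ v, comp x v = K + 1) (x : X) (z : S) :
    ((univ.filter fun x' => hub x' = z ∧ comp x' + Pi.single (hub x) 1 = comp x + Pi.single z 1).card : ℝ) = 1 := by
  -- the target composition `N = comp x − δ_h + δ_z`
  set N : S → ℕ := fun v => comp x v + (if v = z then 1 else 0) - (if v = hub x then 1 else 0) with hNdef
  have hh1 : 1 ≤ comp x (hub x) := Nat.one_le_iff_ne_zero.mpr (hhub x)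
  have hNeq : ∀ M : S → ℕ, M + Pi.single (hub x) 1 = comp x + Pi.single z 1 ↔ M = N := by
    intro M
    constructor
    · intro h; funext v; have := congr_fun h v; simp only [Pi.add_apply, Pi.single_apply] at this; rw [hNdef]; simp only; omega
    · intro h; subst h; funext v; simp only [hNdef, Pi.add_apply, Pi.single_apply]
      by_cases hv : v = hub x
      · subst hv; simp only [if_true]
        by_cases hz : hub x = z
        · simp [hz]
        · simp [hz]; omega
      · simp only [if_neg hv]; omega
  have hNsum : ∑ v, N v = K + 1 := by
    have h1 : ∑ v, N v + 1 = (K + 1) + 1 := by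
      have : ∑ v, (N v + (if v = hub x then 1 else 0)) = ∑ v, (comp x v + (if v = z then 1 else 0)) :=
        sum_congr rfl fun v _ => by
          simp only [hNdef]
          by_cases hv : v = hub x
          · subst hv; simp only [if_true]
            by_cases hz : hub x = z
            · simp [hz]
            · simp [hz]; omega
          · simp only [if_neg hv]; omega
      rw [sum_add_distrib, sum_add_distrib, hsum x] at this
      simpa using this
    omega
  have hNz : N z ≠ 0 := by
    simp only [hNdef, if_true]
    by_cases hz : z = hub x
    · subst hz; simp; omega
    · rw [if_neg hz]; omega
  have hfilt : (univ.filter fun x' => hub x' = z ∧ comp x' + Pi.single (hub x) 1 = comp x + Pi.single z 1) = (univ.filter fun x' => hub x' = z ∧ comp x' = N) :=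
    filter_congr fun x' _ => by rw [hNeq (comp x')]
  rw [hfilt, star_fiber_card hinj hsurj hhub z N hNsum, if_neg hNz]

/-- **`B` has unit row sums** (`Σ μ_0 = 1`). [ours] -/
theorem starStep_redraw_rowsum (hinj : ∀ x x', hub x = hub x' → comp x = comp x' → x = x')
    (hsurj : ∀ (z : S) (N : S → ℕ), ∑ v, N v = K + 1 → N z ≠ 0 → ∃ x, hub x = z ∧ comp x = N) (hhub : ∀ x, comp x (hub x) ≠ 0)
    (hsum : ∀ x, ∑ v, comp x v = K + 1) (hμ1 : ∑ v, μ0 v = 1)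
    (hB : ∀ x x', Bst x x' = μ0 (hub x') * (if comp x' + Pi.single (hub x) 1 = comp x + Pi.single (hub x') 1 then 1 else 0)) (x : X) :
    ∑ x', Bst x x' = 1 := by
  classical
  have e1 : ∀ x', Bst x x' = ∑ z, (if hub x' = z ∧ comp x' + Pi.single (hub x) 1 = comp x + Pi.single z 1 then μ0 z else 0) := by
    intro x'
    rw [hB]
    rw [show (∑ z, (if hub x' = z ∧ comp x' + Pi.single (hub x) 1 = comp x + Pi.single z 1 then μ0 z else 0))
        = ∑ z, (if hub x' = z then (if comp x' + Pi.single (hub x) 1 = comp x + Pi.single z 1 then μ0 z else 0) else 0) from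
      sum_congr rfl fun z _ => by by_cases h1 : hub x' = z <;> by_cases h2 : comp x' + Pi.single (hub x) 1 = comp x + Pi.single z 1 <;> simp [h1, h2]]
    rw [Finset.sum_ite_eq]; simp only [mem_univ, if_true]; split_ifs <;> simp
  simp_rw [e1]
  rw [sum_comm, ← hμ1]
  refine sum_congr rfl fun z _ => ?_
  rw [← Finset.sum_filter, sum_const, nsmul_eq_mul, star_redraw_fiber_card hinj hsurj hhub hsum x z, one_mul]

omit [Fintype X] [Fintype S] [DecidableEq S] in
/-- The redraw relations compose: `x → x''` then `x'' → x'` forces `comp x' + δ_{hub x} = comp x + δ_{hub x'}`, and conversely. [ours] -/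
theorem star_redraw_compose [DecidableEq S] {x x'' x' : X} (h1 : comp x'' + Pi.single (hub x) 1 = comp x + Pi.single (hub x'') 1) :
    comp x' + Pi.single (hub x'') 1 = comp x'' + Pi.single (hub x') 1 ↔ comp x' + Pi.single (hub x) 1 = comp x + Pi.single (hub x') 1 := by
  constructor
  · intro h2
    have : comp x' + Pi.single (hub x) 1 + Pi.single (hub x'') 1 = comp x + Pi.single (hub x') 1 + Pi.single (hub x'') 1 := by
      calc comp x' + Pi.single (hub x) 1 + Pi.single (hub x'') 1 = (comp x' + Pi.single (hub x'') 1) + Pi.single (hub x) 1 := by abel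
        _ = comp x'' + Pi.single (hub x') 1 + Pi.single (hub x) 1 := by rw [h2]
        _ = (comp x'' + Pi.single (hub x) 1) + Pi.single (hub x') 1 := by abel
        _ = comp x + Pi.single (hub x'') 1 + Pi.single (hub x') 1 := by rw [h1]
        _ = comp x + Pi.single (hub x') 1 + Pi.single (hub x'') 1 := by abel
    exact add_right_cancel this
  · intro h2
    have : comp x' + Pi.single (hub x'') 1 + Pi.single (hub x) 1 = comp x'' + Pi.single (hub x') 1 + Pi.single (hub x) 1 := by
      calc comp x' + Pi.single (hub x'') 1 + Pi.single (hub x) 1 = (comp x' + Pi.single (hub x) 1) + Pi.single (hub x'') 1 := by abel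
        _ = comp x + Pi.single (hub x') 1 + Pi.single (hub x'') 1 := by rw [h2]
        _ = (comp x + Pi.single (hub x'') 1) + Pi.single (hub x') 1 := by abel
        _ = comp x'' + Pi.single (hub x) 1 + Pi.single (hub x') 1 := by rw [← h1]
        _ = comp x'' + Pi.single (hub x') 1 + Pi.single (hub x) 1 := by abel
    exact add_right_cancel this

/-- **`B` is idempotent:** `Σ_{x''} B(x,x'')B(x'',x') = B(x,x')` (redrawing twice is redrawing once). [ours] -/
theorem starStep_redraw_idem (hinj : ∀ x x', hub x = hub x' → comp x = comp x' → x = x')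
    (hsurj : ∀ (z : S) (N : S → ℕ), ∑ v, N v = K + 1 → N z ≠ 0 → ∃ x, hub x = z ∧ comp x = N) (hhub : ∀ x, comp x (hub x) ≠ 0)
    (hsum : ∀ x, ∑ v, comp x v = K + 1) (hμ1 : ∑ v, μ0 v = 1)
    (hB : ∀ x x', Bst x x' = μ0 (hub x') * (if comp x' + Pi.single (hub x) 1 = comp x + Pi.single (hub x') 1 then 1 else 0)) (x x' : X) :
    ∑ x'', Bst x x'' * Bst x'' x' = Bst x x' := by
  classical
  -- `B(x,x'')B(x'',x') = B(x,x'')·μ0(hub x')·𝟙{comp x' + δ_{hub x} = comp x + δ_{hub x'}}`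
  have e : ∀ x'', Bst x x'' * Bst x'' x' = Bst x x'' * (μ0 (hub x') * (if comp x' + Pi.single (hub x) 1 = comp x + Pi.single (hub x') 1 then 1 else 0)) := by
    intro x''
    rw [hB x x'', hB x'' x']
    by_cases h1 : comp x'' + Pi.single (hub x) 1 = comp x + Pi.single (hub x'') 1
    · rw [if_pos h1]
      by_cases h2 : comp x' + Pi.single (hub x'') 1 = comp x'' + Pi.single (hub x') 1
      · rw [if_pos h2, if_pos ((star_redraw_compose h1).mp h2)]
      · rw [if_neg h2, if_neg (fun h => h2 ((star_redraw_compose h1).mpr h))]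
    · rw [if_neg h1]; ring
  rw [sum_congr rfl fun x'' _ => e x'', ← sum_mul, starStep_redraw_rowsum hinj hsurj hhub hsum hμ1 hB x, one_mul, hB x x']

/-! ## §4 The stationary law `π_S` and the reversibility of `B` -/

omit [Fintype X] [DecidableEq S] in
/-- **The weight identity:** `g(M + δ_h)·(M(h)+1) = μ_0(h)W_h·g(M)` for `g(N) = Π_v (μ_0(v)W_v)^{N(v)}/N(v)!`. [ours] -/
theorem star_weight_succ [DecidableEq S] (hg : ∀ N, g N = ∏ v, (μ0 v * W v) ^ (N v) / ((N v).factorial : ℝ)) (M : S → ℕ) (h : S) :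
    g (M + (Pi.single h 1 : S → ℕ)) * ((M h : ℝ) + 1) = μ0 h * W h * g M := by
  rw [hg, hg]
  rw [← Finset.mul_prod_erase univ _ (mem_univ h), ← Finset.mul_prod_erase univ (fun v => (μ0 v * W v) ^ (M v) / ((M v).factorial : ℝ)) (mem_univ h)]
  have hoff : ∏ v ∈ univ.erase h, (μ0 v * W v) ^ ((M + (Pi.single h 1 : S → ℕ)) v) / (((M + (Pi.single h 1 : S → ℕ)) v).factorial : ℝ)
      = ∏ v ∈ univ.erase h, (μ0 v * W v) ^ (M v) / ((M v).factorial : ℝ) :=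
    prod_congr rfl fun v hv => by rw [Pi.add_apply, Pi.single_eq_of_ne (ne_of_mem_erase hv), add_zero]
  rw [hoff]
  have hh : (M + (Pi.single h 1 : S → ℕ)) h = M h + 1 := by simp
  rw [hh, Nat.factorial_succ, Nat.cast_mul, pow_succ]
  have hf : ((M h).factorial : ℝ) ≠ 0 := by exact_mod_cast (Nat.factorial_pos _).ne'
  have hm1 : ((M h + 1 : ℕ) : ℝ) = (M h : ℝ) + 1 := by push_cast; ring
  rw [hm1]
  field_simp

omit [Fintype X] in
/-- **`B` is reversible w.r.t. `π_S`.** [ours] -/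
theorem starStep_redraw_reversible (hhub : ∀ x, comp x (hub x) ≠ 0) (hW : ∀ v, 0 < W v)
    (hg : ∀ N, g N = ∏ v, (μ0 v * W v) ^ (N v) / ((N v).factorial : ℝ))
    (hπS : ∀ x, πS x = g (comp x) * ((comp x (hub x) : ℝ) / W (hub x)) / Z)
    (hB : ∀ x x', Bst x x' = μ0 (hub x') * (if comp x' + Pi.single (hub x) 1 = comp x + Pi.single (hub x') 1 then 1 else 0)) (x x' : X) :
    πS x * Bst x x' = πS x' * Bst x' x := by
  rw [hB x x', hB x' x]
  by_cases hc : comp x' + Pi.single (hub x) 1 = comp x + Pi.single (hub x') 1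
  · rw [if_pos hc, if_pos hc.symm, hπS, hπS, mul_one, mul_one]
    -- the common cold composition `M`: `comp x = M + δ_{hub x}`, `comp x' = M + δ_{hub x'}`
    obtain ⟨M, hM⟩ : ∃ M : S → ℕ, comp x = M + Pi.single (hub x) 1 := by
      refine ⟨comp x - Pi.single (hub x) 1, ?_⟩
      funext v; simp only [Pi.add_apply, Pi.sub_apply, Pi.single_apply]
      by_cases hv : v = hub x
      · subst hv; simp; have := Nat.one_le_iff_ne_zero.mpr (hhub x); omega
      · simp [hv]
    have hM' : comp x' = M + Pi.single (hub x') 1 := by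
      have : comp x' + Pi.single (hub x) 1 = M + Pi.single (hub x') 1 + Pi.single (hub x) 1 := by rw [hc, hM]; abel
      exact add_right_cancel this
    rw [hM', hM]
    have ex : (((M + Pi.single (hub x) 1 : S → ℕ) (hub x) : ℕ) : ℝ) = (M (hub x) : ℝ) + 1 := by simp
    have ex' : (((M + Pi.single (hub x') 1 : S → ℕ) (hub x') : ℕ) : ℝ) = (M (hub x') : ℝ) + 1 := by simp
    rw [ex, ex']
    have e1 := star_weight_succ hg M (hub x)
    have e2 := star_weight_succ hg M (hub x')
    have hWx := hW (hub x); have hWx' := hW (hub x')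
    calc g (M + Pi.single (hub x) 1) * (((M (hub x) : ℝ) + 1) / W (hub x)) / Z * μ0 (hub x')
        = (g (M + Pi.single (hub x) 1) * ((M (hub x) : ℝ) + 1)) / W (hub x) / Z * μ0 (hub x') := by ring
      _ = (μ0 (hub x) * W (hub x) * g M) / W (hub x) / Z * μ0 (hub x') := by rw [e1]
      _ = μ0 (hub x) * μ0 (hub x') * g M / Z := by field_simp
      _ = (μ0 (hub x') * W (hub x') * g M) / W (hub x') / Z * μ0 (hub x) := by field_simp
      _ = (g (M + Pi.single (hub x') 1) * ((M (hub x') : ℝ) + 1)) / W (hub x') / Z * μ0 (hub x) := by rw [e2]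
      _ = g (M + Pi.single (hub x') 1) * (((M (hub x') : ℝ) + 1) / W (hub x')) / Z * μ0 (hub x) := by ring
  · rw [if_neg hc, if_neg (fun h => hc h.symm), mul_zero, mul_zero, mul_zero, mul_zero]

/-! ## §5 The resolvent kernel `U` and the cycle chain `UB` -/

/-- **The row equation of `U`:** `U = (1−σ)I + σUA` for `U(x,x') = 𝟙{comp x' = comp x}u_x(hub x')`. [ours] -/
theorem starStep_resolvent_row [DecidableEq X] (hinj : ∀ x x', hub x = hub x' → comp x = comp x' → x = x')
    (hsurj : ∀ (z : S) (N : S → ℕ), ∑ v, N v = K + 1 → N z ≠ 0 → ∃ x, hub x = z ∧ comp x = N) (hhub : ∀ x, comp x (hub x) ≠ 0)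
    (hW : ∀ v, 0 < W v) (hacc : ∀ h v, acc h v = min 1 (W h / W v)) (hK : 1 ≤ K) (hsum : ∀ x, ∑ v, comp x v = K + 1)
    (hKoff : ∀ N h v, h ≠ v → Kh N h v = if N h = 0 then 0 else (N v : ℝ) / K * acc h v) (hKdiag : ∀ N h, Kh N h h = 1 - ∑ v ∈ univ.erase h, Kh N h v)
    (hσ0 : 0 ≤ σ) (hσ1 : σ < 1) (hu : ∀ x v, u x v = (1 - σ) * (if v = hub x then (1 : ℝ) else 0) + σ * ∑ h, u x h * Kh (comp x) h v)
    (hA : ∀ x x', Ast x x' = if comp x' = comp x then Kh (comp x) (hub x) (hub x') else 0)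
    (hUst : ∀ x x', Ust x x' = if comp x' = comp x then u x (hub x') else 0) (x y : X) :
    Ust x y = (1 - σ) * (if x = y then 1 else 0) + σ * ∑ z, Ust x z * Ast z y := by
  have hlegal := finiteOdds_endHub_legal hW hacc hKoff hKdiag hK hsum hhub hσ0 hσ1 hu
  -- `Σ_z U(x,z)A(z,y) = 𝟙{comp y = comp x}·Σ_{v present} u_x(v)Kh(v, hub y)`
  have e1 : ∑ z, Ust x z * Ast z y = if comp y = comp x then ∑ v, u x v * Kh (comp x) v (hub y) else 0 := by
    have : ∀ z, Ust x z * Ast z y = if comp z = comp x then (if comp y = comp x then u x (hub z) * Kh (comp x) (hub z) (hub y) else 0) else 0 := by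
      intro z; rw [hUst, hA]
      by_cases h1 : comp z = comp x
      · rw [if_pos h1, if_pos h1, h1]
        by_cases h2 : comp y = comp x
        · rw [if_pos h2, if_pos h2]
        · rw [if_neg h2, if_neg h2, mul_zero]
      · rw [if_neg h1, if_neg h1, zero_mul]
    rw [sum_congr rfl fun z _ => this z,
      show (∑ z, if comp z = comp x then (if comp y = comp x then u x (hub z) * Kh (comp x) (hub z) (hub y) else 0) else 0)
        = ∑ v, (if comp x v = 0 then 0 else (if comp y = comp x then u x v * Kh (comp x) v (hub y) else 0)) from
        star_sum_fiber hinj hsurj hhub (comp x) (hsum x) (fun a => if comp y = comp x then u x a * Kh (comp x) a (hub y) else 0)]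
    by_cases h2 : comp y = comp x
    · simp only [if_pos h2]
      refine sum_congr rfl fun v _ => ?_
      by_cases hv : comp x v = 0
      · rw [if_pos hv]
        have : u x v = 0 := by by_contra h; exact hlegal x v h hv
        rw [this, zero_mul]
      · rw [if_neg hv]
    · simp [h2]
  rw [e1, hUst]
  by_cases h2 : comp y = comp x
  · rw [if_pos h2, if_pos h2, hu x (hub y)]
    by_cases hxy : x = y
    · subst hxy; simp
    · have : hub y ≠ hub x := fun h => hxy (hinj x y h.symm h2.symm)
      rw [if_neg this, if_neg hxy]
  · have hxy : x ≠ y := fun h => h2 (by rw [h])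
    rw [if_neg h2, if_neg h2, if_neg hxy]; ring

/-- **The column equation of `U`** (the hypothesis-equation of file X1), from the row equation by X1's `resolventKernel_left_of_right`. [ours] -/
theorem starStep_resolvent_col [DecidableEq X] (hinj : ∀ x x', hub x = hub x' → comp x = comp x' → x = x')
    (hsurj : ∀ (z : S) (N : S → ℕ), ∑ v, N v = K + 1 → N z ≠ 0 → ∃ x, hub x = z ∧ comp x = N) (hhub : ∀ x, comp x (hub x) ≠ 0)
    (hW : ∀ v, 0 < W v) (hacc : ∀ h v, acc h v = min 1 (W h / W v)) (hK : 1 ≤ K) (hsum : ∀ x, ∑ v, comp x v = K + 1)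
    (hKoff : ∀ N h v, h ≠ v → Kh N h v = if N h = 0 then 0 else (N v : ℝ) / K * acc h v) (hKdiag : ∀ N h, Kh N h h = 1 - ∑ v ∈ univ.erase h, Kh N h v)
    (hσ0 : 0 ≤ σ) (hσ1 : σ < 1) (hu : ∀ x v, u x v = (1 - σ) * (if v = hub x then (1 : ℝ) else 0) + σ * ∑ h, u x h * Kh (comp x) h v)
    (hA : ∀ x x', Ast x x' = if comp x' = comp x then Kh (comp x) (hub x) (hub x') else 0)
    (hUst : ∀ x x', Ust x x' = if comp x' = comp x then u x (hub x') else 0) :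
    ∀ x y, Ust x y = (1 - σ) * (if x = y then 1 else 0) + σ * ∑ z, Ast x z * Ust z y := by
  have h0 : ∀ x x', 0 ≤ Ast x x' := starStep_swap_nonneg hW hacc hK hsum hKoff hKdiag hA
  have h1 : ∀ x, ∑ x', Ast x x' = 1 := starStep_swap_rowsum hinj hsurj hhub hsum hKoff hKdiag hA
  have hrow : ∀ x y, Ust x y = (1 - σ) * (if x = y then 1 else 0) + σ * ∑ z, Ust x z * Ast z y :=
    fun x y => starStep_resolvent_row hinj hsurj hhub hW hacc hK hsum hKoff hKdiag hσ0 hσ1 hu hA hUst x y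
  exact resolventKernel_left_of_right h0 h1 hσ0 hσ1 hrow

/-- **`UB` is the refresh-cycle chain of chapter W:** `Σ_{x''} U(x,x'')B(x'',x') = Σ_a u_x(a)μ_0(hub x')𝟙{comp x' + δ_a = comp x + δ_{hub x'}} = P(x,x')`. [ours] -/
theorem starStep_cycle_eq (hinj : ∀ x x', hub x = hub x' → comp x = comp x' → x = x')
    (hsurj : ∀ (z : S) (N : S → ℕ), ∑ v, N v = K + 1 → N z ≠ 0 → ∃ x, hub x = z ∧ comp x = N) (hhub : ∀ x, comp x (hub x) ≠ 0)
    (hW : ∀ v, 0 < W v) (hacc : ∀ h v, acc h v = min 1 (W h / W v)) (hK : 1 ≤ K) (hsum : ∀ x, ∑ v, comp x v = K + 1)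
    (hKoff : ∀ N h v, h ≠ v → Kh N h v = if N h = 0 then 0 else (N v : ℝ) / K * acc h v) (hKdiag : ∀ N h, Kh N h h = 1 - ∑ v ∈ univ.erase h, Kh N h v)
    (hσ0 : 0 ≤ σ) (hσ1 : σ < 1) (hu : ∀ x v, u x v = (1 - σ) * (if v = hub x then (1 : ℝ) else 0) + σ * ∑ h, u x h * Kh (comp x) h v)
    (hB : ∀ x x', Bst x x' = μ0 (hub x') * (if comp x' + Pi.single (hub x) 1 = comp x + Pi.single (hub x') 1 then 1 else 0))
    (hUst : ∀ x x', Ust x x' = if comp x' = comp x then u x (hub x') else 0)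
    {P : X → X → ℝ} (hP : ∀ x x', P x x' = ∑ a, u x a * (μ0 (hub x') * (if comp x' + Pi.single a 1 = comp x + Pi.single (hub x') 1 then (1 : ℝ) else 0)))
    (x x' : X) : ∑ x'', Ust x x'' * Bst x'' x' = P x x' := by
  have hlegal := finiteOdds_endHub_legal hW hacc hKoff hKdiag hK hsum hhub hσ0 hσ1 hu
  -- the summand as a function of the hub content of `x''`
  set φ : S → ℝ := fun a => u x a * (μ0 (hub x') * (if comp x' + Pi.single a 1 = comp x + Pi.single (hub x') 1 then (1 : ℝ) else 0)) with hφ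
  have e : ∀ x'', Ust x x'' * Bst x'' x' = if comp x'' = comp x then φ (hub x'') else 0 := by
    intro x''
    by_cases h1 : comp x'' = comp x
    · rw [if_pos h1, hφ, hUst, hB, if_pos h1, h1]
    · rw [if_neg h1, hUst, if_neg h1, zero_mul]
  have key := star_sum_fiber hinj hsurj hhub (comp x) (hsum x) φ
  rw [sum_congr rfl fun x'' _ => e x'', key, hP]
  refine sum_congr rfl fun a _ => ?_
  by_cases ha : comp x a = 0
  · rw [if_pos ha]
    have : u x a = 0 := by by_contra h; exact hlegal x a h ha
    rw [this, zero_mul]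
  · rw [if_neg ha]

end StarStep

end Summit.Ventures.LatticeQCDFlow.Scaling
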